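import Summits.Ventures.HodgeRepro.Night3ExtTop

/-!
# Poincaré duality on the exterior algebra of a finite free module: the top-degree pairing is perfect

Blind re-derivation cell `pub-hodge-repro`, seat `night-3` (gen 6, row D; NIGHT3.md §13.8).  Imports gen 5's
`Night3ExtTop` (`univPC`, the top form `ιMultiDual R N b (univPC hN)`).  Namespace `HodgeRepro.Night3.ExtTop`.

For `M` free with a basis `b` indexed by a finite linearly ordered `I`, `|I| = d + e`:

* `topPair b d e hN : ⋀^d M →ₗ ⋀^e M →ₗ R`, `(x, z) ↦ ∫ x ∧ z` (the `e_univ`-coordinate of the graded product);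
* `topPair_basis_basis_of_not_disjoint` / `topPair_basis_basis_of_disjoint`: on the wedge basis
  `∫ e_S ∧ e_T = 0` unless `T = Sᶜ`, and `∫ e_S ∧ e_{Sᶜ} = sign(π_{S,Sᶜ}) = ±1` (Mathlib's
  `ιMulti_family_mul_of_disjoint`; `S ⊔ Sᶜ = univ`);
* **`eq_zero_of_forall_topPair_eq_zero_right`** / **`eq_zero_of_forall_topPair_eq_zero_left`** (Poincaré duality):
  `z ∈ ⋀^e` pairing to `0` with every `x ∈ ⋀^d` is `0`, and symmetrically — no characteristic assumption
  (the signs are units);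
* `ιMultiDual_univPC_congr`: the top form at two spellings of the same degree agrees.

READING: `H^•(B, ℂ) = ⋀^• H^1(B, ℂ)` for an abelian variety `B`, with `∫` the top coordinate, is the printed
structure (docstrings of the lineage, not modelled); this file is pure multilinear algebra.  Nothing here says
anything about the status of the Hodge conjecture for CM abelian varieties, which is NOT proved.
-/

set_option autoImplicit false

open Module Finset Function

namespace HodgeRepro.Night3.ExtTop

open ExteriorAlgebra Set Set.powersetCard

variable {R : Type*} [CommRing R] {M : Type*} [AddCommGroup M] [Module R M]

/-- The graded product: `x ∈ ⋀^d`, `z ∈ ⋀^e` give `x * z ∈ ⋀^{d+e}`. -/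
theorem mul_mem_add {d e : ℕ} {x z : ExteriorAlgebra R M} (hx : x ∈ ⋀[R]^d M) (hz : z ∈ ⋀[R]^e M) :
    x * z ∈ ⋀[R]^(d + e) M := by
  rw [exteriorPower, pow_add]
  exact Submodule.mul_mem_mul hx hz

variable {I : Type*} [LinearOrder I] [Fintype I] (b : Basis I R M)

/-- **The top-degree pairing** `(x, z) ↦ ∫ x ∧ z` on `⋀^d M × ⋀^e M`, `|I| = d + e`. -/
noncomputable def topPair (d e : ℕ) (hN : Fintype.card I = d + e) : ⋀[R]^d M →ₗ[R] ⋀[R]^e M →ₗ[R] R :=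
  LinearMap.mk₂ R (fun x z => exteriorPower.ιMultiDual R (d + e) b (univPC hN) ⟨x * z, mul_mem_add x.2 z.2⟩)
    (fun x₁ x₂ z => by
      rw [← map_add]
      congr 1
      ext
      simp only [Submodule.coe_add, add_mul])
    (fun c x z => by
      rw [← map_smul]
      congr 1
      ext
      simp only [Submodule.coe_smul, smul_mul_assoc])
    (fun x z₁ z₂ => by
      rw [← map_add]
      congr 1
      ext
      simp only [Submodule.coe_add, mul_add])
    (fun c x z => by
      rw [← map_smul]
      congr 1
      ext
      simp only [Submodule.coe_smul, mul_smul_comm])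

/-- `topPair` unfolded. -/
theorem topPair_apply (d e : ℕ) (hN : Fintype.card I = d + e) (x : ⋀[R]^d M) (z : ⋀[R]^e M) :
    topPair b d e hN x z = exteriorPower.ιMultiDual R (d + e) b (univPC hN) ⟨x * z, mul_mem_add x.2 z.2⟩ := rfl

/-- The top form at two spellings `N = N'` of the degree agrees. -/
theorem ιMultiDual_univPC_congr {N N' : ℕ} (h : N = N') (hN : Fintype.card I = N) (hN' : Fintype.card I = N')
    {w : ExteriorAlgebra R M} (hw : w ∈ ⋀[R]^N M) (hw' : w ∈ ⋀[R]^N' M) :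
    exteriorPower.ιMultiDual R N b (univPC hN) ⟨w, hw⟩ = exteriorPower.ιMultiDual R N' b (univPC hN') ⟨w, hw'⟩ := by
  subst h
  rfl

omit [Fintype I] in
/-- The wedge-basis vector `e_S` of `⋀^d M` (Mathlib's `Module.Basis.exteriorPower`), as an element of the algebra,
is `ιMulti_family b S`. -/
theorem coe_basis_exteriorPower (d : ℕ) (S : powersetCard I d) :
    ((b.exteriorPower d S : ⋀[R]^d M) : ExteriorAlgebra R M) = ExteriorAlgebra.ιMulti_family R d b S := by
  rw [exteriorPower.basis_apply, exteriorPower.ιMulti_family_apply_coe]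

omit [LinearOrder I] in
/-- A disjoint union of an `S` of card `d` and a `T` of card `e` in an `I` of card `d + e` is `univ`. -/
theorem disjUnion_eq_univPC {d e : ℕ} (hN : Fintype.card I = d + e) {S : powersetCard I d}
    {T : powersetCard I e} (h : Disjoint S.val T.val) : disjUnion h = univPC hN := by
  apply Subtype.ext
  rw [Set.powersetCard.coe_disjUnion]
  exact Finset.eq_univ_of_card _ (by rw [Finset.card_disjUnion, card_eq S, card_eq T, hN])

/-- `∫ e_S ∧ e_T = 0` when `S` and `T` meet. -/
theorem topPair_basis_basis_of_not_disjoint {d e : ℕ} (hN : Fintype.card I = d + e) (S : powersetCard I d)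
    (T : powersetCard I e) (h : ¬Disjoint S.val T.val) :
    topPair b d e hN (b.exteriorPower d S) (b.exteriorPower e T) = 0 := by
  rw [topPair_apply]
  have hz : (⟨(b.exteriorPower d S : ExteriorAlgebra R M) * b.exteriorPower e T,
      mul_mem_add (b.exteriorPower d S).2 (b.exteriorPower e T).2⟩ : ⋀[R]^(d + e) M) = 0 := by
    ext
    show (b.exteriorPower d S : ExteriorAlgebra R M) * b.exteriorPower e T = _
    rw [Submodule.coe_zero, coe_basis_exteriorPower, coe_basis_exteriorPower,
      ιMulti_family_mul_of_not_disjoint R b S T h]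
  rw [hz, map_zero]

/-- `∫ e_S ∧ e_T = sign(π_{S,T}) = ±1` when `S` and `T` are disjoint (then `S ⊔ T = univ`). -/
theorem topPair_basis_basis_of_disjoint {d e : ℕ} (hN : Fintype.card I = d + e) (S : powersetCard I d)
    (T : powersetCard I e) (h : Disjoint S.val T.val) :
    topPair b d e hN (b.exteriorPower d S) (b.exteriorPower e T) = (((permOfDisjoint h).sign : ℤ) : R) := by
  rw [topPair_apply]
  have hz : (⟨(b.exteriorPower d S : ExteriorAlgebra R M) * b.exteriorPower e T,
      mul_mem_add (b.exteriorPower d S).2 (b.exteriorPower e T).2⟩ : ⋀[R]^(d + e) M) =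
      ((permOfDisjoint h).sign : ℤ) • exteriorPower.ιMulti_family R (d + e) b (disjUnion h) := by
    ext
    show (b.exteriorPower d S : ExteriorAlgebra R M) * b.exteriorPower e T = _
    rw [AddSubgroupClass.coe_zsmul, exteriorPower.ιMulti_family_apply_coe, coe_basis_exteriorPower,
      coe_basis_exteriorPower, ιMulti_family_mul_of_disjoint R b S T h, Units.smul_def]
  rw [hz, map_zsmul, disjUnion_eq_univPC hN h, exteriorPower.ιMultiDual_apply_diag, zsmul_one]

/-- A sign `±1` is a unit: `c · sign = 0 ⟹ c = 0`. -/
theorem eq_zero_of_mul_sign_eq_zero {α : Type*} [Fintype α] [DecidableEq α] {c : R} {π : Equiv.Perm α}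
    (h : c * ((Equiv.Perm.sign π : ℤ) : R) = 0) : c = 0 := by
  rcases Int.units_eq_one_or (Equiv.Perm.sign π) with hs | hs <;> rw [hs] at h
  · simpa using h
  · simpa using h

/-- Two `e`-subsets of `I` disjoint from the same `d`-subset `S`, `|I| = d + e`, are both `Sᶜ`. -/
theorem eq_of_disjoint_of_disjoint {d e : ℕ} (hN : Fintype.card I = d + e) {S : powersetCard I d}
    {T T' : powersetCard I e} (hT : Disjoint S.val T.val) (hT' : Disjoint S.val T'.val) : T' = T := by
  apply Subtype.ext
  have h1 : T.val ⊆ S.valᶜ := fun x hx => by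
    rw [Finset.mem_compl]; exact Finset.disjoint_right.mp hT hx
  have h2 : T'.val ⊆ S.valᶜ := fun x hx => by
    rw [Finset.mem_compl]; exact Finset.disjoint_right.mp hT' hx
  have hc : (S.valᶜ).card = e := by rw [Finset.card_compl, card_eq S, hN, Nat.add_sub_cancel_left]
  rw [Finset.eq_of_subset_of_card_le h1 (by rw [hc, card_eq T]),
    Finset.eq_of_subset_of_card_le h2 (by rw [hc, card_eq T'])]

/-- **Poincaré duality (right)**: `z ∈ ⋀^e M` with `∫ x ∧ z = 0` for every `x ∈ ⋀^d M` is `0` (`|I| = d + e`). -/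
theorem eq_zero_of_forall_topPair_eq_zero_right {d e : ℕ} (hN : Fintype.card I = d + e) (z : ⋀[R]^e M)
    (h : ∀ x : ⋀[R]^d M, topPair b d e hN x z = 0) : z = 0 := by
  classical
  rw [← (b.exteriorPower e).sum_repr z]
  refine Finset.sum_eq_zero fun T _ => ?_
  -- the complementary `d`-subset
  let S : powersetCard I d := compl hN.symm T
  have hST : Disjoint S.val T.val := by
    rw [Finset.disjoint_left]
    intro x hx hx'
    exact (mem_compl (hm := hN.symm) (s := T) (a := x)).mp hx hx'
  have key := h (b.exteriorPower d S)
  rw [← (b.exteriorPower e).sum_repr z, map_sum, Finset.sum_eq_single T] at key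
  · rw [map_smul, smul_eq_mul, topPair_basis_basis_of_disjoint b hN S T hST] at key
    rw [eq_zero_of_mul_sign_eq_zero key, zero_smul]
  · intro T' _ hT'
    rw [map_smul, smul_eq_mul, topPair_basis_basis_of_not_disjoint b hN S T' (fun hd => hT'
      (eq_of_disjoint_of_disjoint hN hST hd)), mul_zero]
  · intro hT
    exact absurd (Finset.mem_univ T) hT

/-- **Poincaré duality (left)**: `x ∈ ⋀^d M` with `∫ x ∧ z = 0` for every `z ∈ ⋀^e M` is `0` (`|I| = d + e`). -/
theorem eq_zero_of_forall_topPair_eq_zero_left {d e : ℕ} (hN : Fintype.card I = d + e) (x : ⋀[R]^d M)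
    (h : ∀ z : ⋀[R]^e M, topPair b d e hN x z = 0) : x = 0 := by
  classical
  rw [← (b.exteriorPower d).sum_repr x]
  refine Finset.sum_eq_zero fun S _ => ?_
  -- the complementary `e`-subset
  let T : powersetCard I e := compl ((Nat.add_comm e d).trans hN.symm) S
  have hST : Disjoint S.val T.val := by
    rw [Finset.disjoint_right]
    intro x hx hx'
    exact (mem_compl (hm := (Nat.add_comm e d).trans hN.symm) (s := S) (a := x)).mp hx hx'
  have key := h (b.exteriorPower e T)
  rw [← (b.exteriorPower d).sum_repr x, map_sum, LinearMap.sum_apply, Finset.sum_eq_single S] at key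
  · rw [map_smul, LinearMap.smul_apply, smul_eq_mul, topPair_basis_basis_of_disjoint b hN S T hST] at key
    rw [eq_zero_of_mul_sign_eq_zero key, zero_smul]
  · intro S' _ hS'
    rw [map_smul, LinearMap.smul_apply, smul_eq_mul, topPair_basis_basis_of_not_disjoint b hN S' T (fun hd => hS'
      (eq_of_disjoint_of_disjoint ((Nat.add_comm e d).trans hN.symm).symm hST.symm hd.symm)), mul_zero]
  · intro hS
    exact absurd (Finset.mem_univ S) hS

end HodgeRepro.Night3.ExtTop
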